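import Literature.NumberTheory.Transcendental.AndreCriterionAnalyticProofs
import Mathlib.Analysis.Analytic.IsolatedZeros
import HarnessLib

/-!
# The Taylor series of a composite: `𝓣[F ∘ X] = 𝓣[F] ∘ 𝓣[X]`

Topic `Literature/Analysis/Complex`. For `F, X : ℂ → ℂ` analytic at `0` with `X(0) = 0`, the Taylor
series at `0` of `F ∘ X` is the formal composite (`PowerSeries.subst`) of the Taylor series of `F`
and `X` (`taylor_comp`). The Taylor series at `0` is written, as in
`Literature/NumberTheory/Transcendental/AndreCriterionAnalyticProofs.lean` (whose calculus
`taylor_add/mul/pow/sum/congr` we reuse), as the formal power series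
`PowerSeries.mk fun n => (n!)⁻¹ · iteratedDeriv n f 0` (local notation `𝓣[f]`; no definition).

The proof avoids Faà di Bruno and double series: by `dslope`, `F = P_n + u^{n+1} G_n` near `0`
with `P_n` the Taylor polynomial of degree `n` and `G_n` analytic (`exists_taylor_remainder`), so
`𝓣[F ∘ X] ≡ 𝓣[P_n ∘ X] = Σ_{k ≤ n} aₖ 𝓣[X]ᵏ (mod Xⁿ⁺¹)`, whose `n`-th coefficient is that of
`𝓣[F].subst 𝓣[X]` (`PowerSeries.coeff_subst'`).

Written for the `x`-expansions of modular forms at a cusp in the formalization of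
Calegari–Dimitrov–Tang, *The unbounded denominators conjecture* (arXiv:2109.09040), §3 (the formal
substitution `x^* f` of the Fourier expansion into the uniformizer `x = (λ/16)^{1/N}` versus the
analytic pullback of Remark 16).

## References

* [CalegariDimitrovTang2025] arXiv:2109.09040, §3, proof of Proposition 15 (`x^*f`).
* Folklore (e.g. H. Cartan, *Elementary theory of analytic functions*, Ch. I §2.5: substitution of
  convergent power series).
-/

noncomputable section

open PowerSeries Metric Filter Finset
open scoped Topology Nat

namespace Literature.Analysis.Complex

namespace TaylorComp

open Literature.NumberTheory.Transcendental.AndreCriterion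

/-- The Taylor series of `f : ℂ → ℂ` at `0`, as a formal power series (local notation, as in
`AndreCriterionAnalyticProofs`). -/
local notation3 "𝓣[" f "]" =>
  (PowerSeries.mk fun n => ((Nat.factorial n : ℂ)⁻¹ * iteratedDeriv n f 0) : PowerSeries ℂ)

variable {F G X : ℂ → ℂ}

/-- The Taylor series of the identity is `X`. [folklore] -/
theorem taylor_id : 𝓣[fun u : ℂ => u] = PowerSeries.X := by
  ext n
  rw [coeff_taylor, coeff_X]
  rcases Nat.lt_trichotomy n 1 with h | rfl | h
  · have : n = 0 := by omega
    subst this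
    simp
  · simp
  · rw [if_neg (by omega)]
    obtain ⟨m, rfl⟩ : ∃ m, n = m + 2 := ⟨n - 2, by omega⟩
    have : iteratedDeriv (m + 2) (fun u : ℂ => u) 0 = 0 := by
      rw [iteratedDeriv_succ', iteratedDeriv_succ']
      have h1 : deriv (fun u : ℂ => u) = fun _ => 1 := by funext u; exact deriv_id u
      rw [h1]
      have h2 : deriv (fun _ : ℂ => (1 : ℂ)) = fun _ => 0 := by funext u; exact deriv_const u 1
      rw [h2, iteratedDeriv_const]
      split_ifs <;> rfl
    rw [this, mul_zero]

/-- The Taylor series of `u ↦ uᵏ` is `Xᵏ`. [folklore] -/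
theorem taylor_pow_id (k : ℕ) : 𝓣[fun u : ℂ => u ^ k] = PowerSeries.X ^ k := by
  have h := taylor_pow (f := fun u : ℂ => u) analyticAt_id k
  rw [taylor_id] at h
  have heq : (fun u : ℂ => u ^ k) = (fun u : ℂ => u) ^ k := by funext u; simp
  rw [heq]
  exact h

/-- `𝓣[u ↦ uᵐ G(u)] = Xᵐ 𝓣[G]` for analytic `G`. [folklore] -/
theorem taylor_pow_mul (hG : AnalyticAt ℂ G 0) (m : ℕ) :
    𝓣[fun u : ℂ => u ^ m * G u] = PowerSeries.X ^ m * 𝓣[G] := by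
  have hid : 𝓣[(id : ℂ → ℂ)] = PowerSeries.X := taylor_id
  have heq : (fun u : ℂ => u ^ m * G u) = (id : ℂ → ℂ) ^ m * G := by
    funext u; simp [Pi.pow_apply]
  rw [heq, taylor_mul (analyticAt_id.pow m) hG, taylor_pow analyticAt_id, hid]

/-- The Taylor series of a polynomial function `Σ_{k ≤ n} aₖ uᵏ`. [folklore] -/
theorem taylor_sum_mul_pow (a : ℕ → ℂ) (n : ℕ) :
    𝓣[∑ k ∈ Finset.range (n + 1), fun u : ℂ => a k * u ^ k] =
      ∑ k ∈ Finset.range (n + 1), C (a k) * PowerSeries.X ^ k := by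
  rw [taylor_sum (f := fun k => fun u : ℂ => a k * u ^ k) _ (fun k _ ↦ ?_)]
  · refine Finset.sum_congr rfl fun k _ ↦ ?_
    rw [taylor_const_mul, taylor_pow_id]
  · exact analyticAt_const.mul (analyticAt_id.pow k)

/-- Coefficients of the Taylor series of a polynomial function. [folklore] -/
theorem coeff_taylor_sum_mul_pow (a : ℕ → ℂ) (n j : ℕ) :
    coeff j 𝓣[∑ k ∈ Finset.range (n + 1), fun u : ℂ => a k * u ^ k] = if j ≤ n then a j else 0 := by
  rw [taylor_sum_mul_pow, map_sum]
  simp only [coeff_C_mul, coeff_X_pow]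
  rw [Finset.sum_congr rfl (fun k _ ↦ show a k * (if j = k then 1 else 0) = if j = k then a k else 0 by
    split_ifs <;> simp), Finset.sum_ite_eq]
  simp only [Finset.mem_range, Nat.lt_succ_iff]

/-- Values of the polynomial function. [folklore] -/
theorem sum_mul_pow_apply (a : ℕ → ℂ) (n : ℕ) (u : ℂ) :
    (∑ k ∈ Finset.range (n + 1), fun u : ℂ => a k * u ^ k) u = ∑ k ∈ Finset.range (n + 1), a k * u ^ k := by
  rw [Finset.sum_apply]

/-- **Taylor's formula with analytic remainder**: for `F` analytic at `0` and every `n`,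
`F(u) = Σ_{k ≤ n} aₖ uᵏ + u^{n+1} G(u)` near `0` with `aₖ = [uᵏ] 𝓣[F]` and `G` analytic at `0`.
[folklore] -/
theorem exists_taylor_remainder (hF : AnalyticAt ℂ F 0) (n : ℕ) :
    ∃ G : ℂ → ℂ, AnalyticAt ℂ G 0 ∧ ∀ᶠ u in 𝓝 0,
      F u = (∑ k ∈ Finset.range (n + 1), coeff k 𝓣[F] * u ^ k) + u ^ (n + 1) * G u := by
  induction n with
  | zero =>
    refine ⟨dslope F 0, ?_, Eventually.of_forall fun u ↦ ?_⟩
    · obtain ⟨p, hp⟩ := hF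
      exact ⟨_, hp.has_fpower_series_dslope_fslope⟩
    · rw [zero_add, Finset.sum_range_one, pow_zero, mul_one, pow_one,
        coeff_zero_eq_constantCoeff_apply, constantCoeff_taylor]
      have := sub_smul_dslope F 0 u
      rw [sub_zero, smul_eq_mul] at this
      rw [this]; ring
  | succ n ih =>
    obtain ⟨G, hG, hGF⟩ := ih
    -- compare Taylor series: `𝓣[F] = 𝓣[P_n] + X^{n+1} 𝓣[G]`, so `G 0 = a_{n+1}`
    have hPa : ∀ k ∈ Finset.range (n + 1), AnalyticAt ℂ (fun u : ℂ ↦ coeff k 𝓣[F] * u ^ k) 0 :=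
      fun k _ ↦ analyticAt_const.mul (analyticAt_id.pow k)
    have hRa : AnalyticAt ℂ (fun u : ℂ ↦ u ^ (n + 1) * G u) 0 := (analyticAt_id.pow _).mul hG
    have hTF : 𝓣[F] = 𝓣[∑ k ∈ Finset.range (n + 1), fun u : ℂ ↦ coeff k 𝓣[F] * u ^ k] +
        PowerSeries.X ^ (n + 1) * 𝓣[G] := by
      rw [← taylor_pow_mul hG, ← taylor_add (Finset.analyticAt_sum _ hPa) hRa]
      refine taylor_congr (hGF.mono fun u hu ↦ ?_)
      rw [hu, Pi.add_apply, sum_mul_pow_apply]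
    have hG0 : G 0 = coeff (n + 1) 𝓣[F] := by
      have := congrArg (coeff (n + 1)) hTF
      rw [map_add, coeff_taylor_sum_mul_pow, if_neg (by omega), zero_add, coeff_X_pow_mul',
        if_pos le_rfl, Nat.sub_self, coeff_zero_eq_constantCoeff_apply, constantCoeff_taylor] at this
      exact this.symm
    refine ⟨dslope G 0, ?_, hGF.mono fun u hu ↦ ?_⟩
    · obtain ⟨p, hp⟩ := hG
      exact ⟨_, hp.has_fpower_series_dslope_fslope⟩
    · have hG' := sub_smul_dslope G 0 u
      rw [sub_zero, smul_eq_mul] at hG'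
      rw [hu, Finset.sum_range_succ _ (n + 1), ← hG0,
        show G u = G 0 + u * dslope G 0 u by rw [hG']; ring]
      ring

/-- Powers of a Taylor series without constant term vanish to that order. [folklore] -/
theorem coeff_pow_taylor_eq_zero (hX0 : X 0 = 0) {d k : ℕ} (hk : k < d) : coeff k (𝓣[X] ^ d) = 0 := by
  have hdvd : PowerSeries.X ∣ 𝓣[X] := by
    rw [X_dvd_iff, constantCoeff_taylor, hX0]
  obtain ⟨Y, hY⟩ := hdvd
  rw [hY, mul_pow, coeff_X_pow_mul', if_neg (not_le.mpr hk)]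

/-- **The Taylor series of a composite is the formal composite**: for `F`, `X` analytic at `0`
with `X(0) = 0`, `𝓣[F ∘ X] = 𝓣[F].subst 𝓣[X]`. [folklore] -/
theorem taylor_comp (hF : AnalyticAt ℂ F 0) (hX : AnalyticAt ℂ X 0) (hX0 : X 0 = 0) :
    𝓣[F ∘ X] = (𝓣[F]).subst 𝓣[X] := by
  have hsub : HasSubst 𝓣[X] := HasSubst.of_constantCoeff_zero' (by rw [constantCoeff_taylor, hX0])
  ext n
  obtain ⟨G, hG, hGF⟩ := exists_taylor_remainder hF n
  set a : ℕ → ℂ := fun k ↦ coeff k 𝓣[F] with ha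
  -- near `0`: `F (X w) = P_n (X w) + (X w)^{n+1} G (X w)`
  have hX0' : Tendsto X (𝓝 0) (𝓝 0) := by
    have := hX.continuousAt.tendsto
    rwa [hX0] at this
  have hgerm : (F ∘ X) =ᶠ[𝓝 0]
      ((∑ k ∈ Finset.range (n + 1), fun w : ℂ ↦ a k * X w ^ k) + fun w ↦ X w ^ (n + 1) * G (X w)) := by
    filter_upwards [hX0'.eventually hGF] with w hw
    rw [Function.comp_apply, hw, Pi.add_apply, Finset.sum_apply]
  have hPa : ∀ k ∈ Finset.range (n + 1), AnalyticAt ℂ (fun w : ℂ ↦ a k * X w ^ k) 0 :=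
    fun k _ ↦ analyticAt_const.mul (hX.pow k)
  have hGX : AnalyticAt ℂ (fun w ↦ G (X w)) 0 := by
    have hG' : AnalyticAt ℂ G (X 0) := by rw [hX0]; exact hG
    exact hG'.comp hX
  have hRa : AnalyticAt ℂ (fun w : ℂ ↦ X w ^ (n + 1) * G (X w)) 0 := (hX.pow _).mul hGX
  rw [taylor_congr hgerm, taylor_add (Finset.analyticAt_sum _ hPa) hRa, map_add]
  -- the remainder contributes nothing to the `n`-th coefficient
  have hR : coeff n 𝓣[fun w : ℂ ↦ X w ^ (n + 1) * G (X w)] = 0 := by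
    have heq : (fun w : ℂ ↦ X w ^ (n + 1) * G (X w)) = X ^ (n + 1) * fun w ↦ G (X w) := by
      funext w; simp [Pi.pow_apply]
    rw [heq, taylor_mul (hX.pow _) hGX, taylor_pow hX, coeff_mul]
    refine Finset.sum_eq_zero fun ij hij ↦ ?_
    have : ij.1 ≤ n := by
      have := Finset.mem_antidiagonal.mp hij; omega
    rw [coeff_pow_taylor_eq_zero hX0 (by omega), zero_mul]
  rw [hR, add_zero]
  -- the polynomial part: `Σ_{k ≤ n} aₖ 𝓣[X]ᵏ`
  rw [taylor_sum _ hPa, map_sum]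
  have hterm : ∀ k, coeff n 𝓣[fun w : ℂ ↦ a k * X w ^ k] = a k * coeff n (𝓣[X] ^ k) := by
    intro k
    have heq : (fun w : ℂ ↦ a k * X w ^ k) = fun w ↦ a k * (X ^ k) w := by
      funext w; simp [Pi.pow_apply]
    rw [heq, taylor_const_mul, coeff_C_mul, taylor_pow hX]
  simp only [hterm]
  -- the formal composite: `Σ_d a_d [wⁿ] 𝓣[X]ᵈ`, where only `d ≤ n` contribute
  rw [coeff_subst' hsub, finsum_eq_sum_of_support_subset (s := Finset.range (n + 1))]
  · rfl
  · intro d hd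
    rw [Function.mem_support] at hd
    by_contra h
    rw [Finset.mem_coe, Finset.mem_range, not_lt] at h
    exact hd (by rw [coeff_pow_taylor_eq_zero hX0 (by omega), smul_zero])

end TaylorComp

end Literature.Analysis.Complex

end
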